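/-
Copyright (c) 2026 the pub-hodgecm-mathlib formalisation cell (harness21).  Prover seat hodgecm-mathlib-F0P3-p01 (g31), «(D-RAM) FOUR-FRAME» road of crux H413, line LH4,
unit U3_Laws, κ-STAGE B brick κG₂ «G₁-κ» (dealer LH4-plan (g11) WORD #52 (a); letter LH4-p09 (g3) `LETTER-kappaBG-tv2.v1` §2 + §4, κ owner LH4-p05 (g3)).
FILE κG₂-C2₀ — THE ρ = 0 SOCKET (root-glued type-2 stratum `(1, 1+s, 1+s)`) AND THE ALL-ρ HEAD.  2026-09-04.
-/
import Summits.HodgeConjecture.HodgeConjecture.Theorems.F0P3cDyRamDiagonalKappaGluedSocketTwo              -- ★ κG₂-C2 p856830 (this seat): the ρ ≥ 1 socket; brings ★ κG₂-B, ★ W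
import Summits.HodgeConjecture.HodgeConjecture.Theorems.F0P3cDyRamDiagonalKappaGluedClassTwoZeroCount      -- ★ κG₂-A2₀ (this seat): `kappaCount_two_latt_glued_zero_rep`; brings ★ p856296, ★ G2-C1∕C2
import Summits.HodgeConjecture.HodgeConjecture.Theorems.F0P3cDyRamDiagonalGluedSocketTwo                   -- ★ M p856489 (this seat): `finsum_mul_stabiliserWeight_eq_mul_finsum`
import HarnessLib

/-!
# Crux `H413`, κ-STAGE B brick κG₂, FILE C2₀: the κ-socket of the ROOT-GLUED type-2 stratum `(1, 1+s, 1+s)` (ρ = 0), and the all-`ρ` head of LETTER κB-G₂ v1 §4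

Cell `hodgecm-mathlib` (D-0151), FLOOR 0, crux item H413 = `stmt-HodgeConjecture-24833`; lane `--supports stmt-HodgeConjecture-24833 --as helper` (count-neutral).  THEOREMS ONLY
(no `def`, no instance, no notation, no `sorry`).  ρ = 0: by ★ F1₂ `stratumTwo_G1_zero_eq` + ★ W `rootPol_eq_root` the stratum is the root-glued `T`-stable family; on the tube
(`1+s ≤ n₁`; `n₂, n₃ ≥ 1` from the datum) every member is stable (★ p856296) and `kappaCount σ ϖ 2 i` is the CONSTANT `Σ_{g ∈ R₁} [window_i]χ_i(g)` (★ κG₂-A2₀, `R₁` = fixed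
classes of valuation `s` modulo `𝔭^{1+s}`, `#R₁ = q−1`), so `Σᶠ κ·w = (Σ_{R₁} …)·Σᶠ w = (★ κG₂-B `sum_bracket_two_level` at ρ = 0)·q^{s∕2}` (★ p856296 `Σᶠ w = q^{s∕2}`) =
`(ω(−1)·q^{s∕2}·((q−1)[2d ≤ s] − [s+2 = 2d]), 0, 0)` — LETTER §2 TUBE₂ at ρ = 0 (REF5 R5-101∕108: (1,3,3) +2, (1,5,5) −4, (1,7,7) −8 at d = 2, q = 2); below the tube the family is
empty (★ p856296 `not_mapGL_latt_rhoZero_eq_of_lt`); there is no glue term at ρ = 0.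
HEADS: `finsum_kappaCount_two_mul_stabiliserWeight_hasAxis_G1_zero` (ρ = 0) and the ALL-ρ head **`finsum_kappaCount_two_mul_stabiliserWeight_hasAxis_G1_all`** = LETTER κB-G₂ v1 §4
binder for binder (`ρ ≥ 0`; ρ ≥ 1 by ★ κG₂-C2 p856830).
HONEST LABEL.  Count-neutral (`--supports`); the κ-laws stay PROVER TARGETS; `HC_CM` is proved only modulo the 7 printed citations (2 remaining named inputs: hLiu418 =
`stmt-HodgeConjecture-24832`, h413 = `stmt-HodgeConjecture-24833`) until rung 0 closes.

## References
* [Kottwitz1986BaseChangeUnits] R. E. Kottwitz, *Base change for unit elements of Hecke algebras*, Compositio Math. 60 (1986), §1 pp. 240–241 (fixed-lattice counts via torus orbits).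
* [LanglandsShelstad1987] R. P. Langlands, D. Shelstad, *On the definition of transfer factors*, Math. Ann. 278 (1987), §3 (the κ-signs).
* [Rogawski1990] J. D. Rogawski, *Automorphic Representations of Unitary Groups in Three Variables*, Ann. of Math. Stud. 123 (1990), §4.9 Prop. 4.9.1 (a) p. 55.
* [Serre1979] J.-P. Serre, *Local Fields*, GTM 67 (1979), Ch. V §3 Prop. 5, Cor. 3; Ch. XV §2.
-/

set_option autoImplicit false

noncomputable section

namespace Summit.HodgeConjecture.HodgeConjecture.Cruxes.H413.F0P3cDyRamDiagonalKappaGluedSocketTwoZero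

open Matrix WithZero
open Literature.NumberTheory.Automorphic Literature.NumberTheory.Automorphic.HermitianLattice
open Literature.NumberTheory.Automorphic.UnitaryLatticeTree Literature.NumberTheory.Automorphic.UnitaryThreeFourFrame
open Literature.NumberTheory.LocalFields.WildQuadraticDatum
open Summit.HodgeConjecture.HodgeConjecture.Cruxes.H413.F0P3cDyRamDiagonalTorusDefs
open Summit.HodgeConjecture.HodgeConjecture.Cruxes.H413.F0P3cDyRamDiagonalStrataDefs
open Summit.HodgeConjecture.HodgeConjecture.Cruxes.H413.F0P3cDyRamDiagonalKappaCountDefs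
open Summit.HodgeConjecture.HodgeConjecture.Cruxes.H413.F0P3cDyRamDiagonalKappaGluedSocketTwo
open Summit.HodgeConjecture.HodgeConjecture.Cruxes.H413.F0P3cDyRamDiagonalKappaGluedClassTwoZeroCount (kappaCount_two_latt_glued_zero_rep)
open Summit.HodgeConjecture.HodgeConjecture.Cruxes.H413.F0P3cDyRamDiagonalKappaGluedClassSumsTwo (sum_bracket_two_level)
open Summit.HodgeConjecture.HodgeConjecture.Cruxes.H413.F0P3cDyRamDiagonalGluedStabiliserIndex (ne_zero_and_v_lt_one_of_v_eq_exp)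
open Summit.HodgeConjecture.HodgeConjecture.Cruxes.H413.F0P3cDyRamDiagonalGluedStratumTwo (stratumTwo_G1_zero_eq stratumTwo_G1_eq_empty_of_odd)
open Summit.HodgeConjecture.HodgeConjecture.Cruxes.H413.F0P3cDyRamDiagonalGluedSocketTwoWeight (rootPol_eq_root)
open Summit.HodgeConjecture.HodgeConjecture.Cruxes.H413.F0P3cDyRamDiagonalGluedSocketTwo (finsum_mul_stabiliserWeight_eq_mul_finsum)
open Summit.HodgeConjecture.HodgeConjecture.Cruxes.H413.F0P3cDyRamDiagonalGluedRhoZero (finsum_stabiliserWeight_rhoZero_tube_typeTwo_eq not_mapGL_latt_rhoZero_eq_of_lt)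
open Summit.HodgeConjecture.HodgeConjecture.Cruxes.H413.F0P3cDyRamDiagonalGluedTorusOrbits (exists_gl_coe_eq_glued)
open Summit.HodgeConjecture.HodgeConjecture.Cruxes.H413.F0P3cDyRamDiagonalGluedClassRepresentatives (exists_fixed_class_representatives)
open scoped Valued WithZero Matrix MatrixGroups

section Socket

variable {K : Type} [Field K] [Valued K ℤᵐ⁰] [CompleteSpace K] [Fintype 𝓀[K]] {σ : K →+* K} {ϖ : K} {d t : ℕ} {α β : K} {N₀ n₁ n₂ n₃ : ℕ}
  {T : GL (Fin 3) K}

/-- **κB-G₂ AT ρ = 0 — THE ROOT-GLUED TYPE-2 STRATUM `(1, 1+s, 1+s)`** (written `(2·0+1, 2·0+1+s, 2·0+1+s)`): `Σᶠ κ_i·w = [2∣s ∧ 1+s ≤ n₁]·(ω(−1)·q^{s∕2}·((q−1)[2d ≤ s] − [s+2 = 2d]), 0, 0)_i`.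
[cite: Kottwitz1986BaseChangeUnits, §1 pp. 240–241] [cite: LanglandsShelstad1987, §3] [cite: Serre1979, Ch. V §3 Prop. 5, Cor. 3] -/
theorem finsum_kappaCount_two_mul_stabiliserWeight_hasAxis_G1_zero (hD : IsRamifiedQuadraticDatum σ ϖ d t) (h2 : Valued.v (2 : K) < 1)
    (hE : IsElementDatum σ ϖ N₀ α β n₁ n₂ n₃) (hN₀ : d ≤ N₀) (hT : (T : Matrix (Fin 3) (Fin 3) K) = Matrix.diagonal ![α, β, 1])
    (s : ℕ) (hs : 1 ≤ s) (i : Fin 3) :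
    ∑ᶠ M ∈ stratumTwo σ ϖ T ![2 * 0 + 1, 2 * 0 + 1 + s, 2 * 0 + 1 + s], (kappaCount σ ϖ 2 i M : ℚ) * stabiliserWeight σ M =
      if 2 ∣ s ∧ 1 + s ≤ n₁ then
        (![(normSign σ (-1 : K) : ℚ) * (Fintype.card 𝓀[K] : ℚ) ^ (s / 2) *
            ((if 2 * d ≤ s then (Fintype.card 𝓀[K] : ℚ) - 1 else 0) - (if s + 2 = 2 * d then 1 else 0)), 0, 0] : Fin 3 → ℚ) i
      else 0 := by
  classical
  obtain ⟨hσ, hvσ, hϖ, hfix, hdd, h1d, -⟩ := id hD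
  obtain ⟨hαn, hβn, -, -, -, h₁, h₂, -, hN1, hN2, -⟩ := hE
  have hα := UnitaryThreeFourFrame.v_eq_one_of_mul_map_eq_one hvσ hαn
  have hβ := UnitaryThreeFourFrame.v_eq_one_of_mul_map_eq_one hvσ hβn
  obtain ⟨hϖ0, hϖ1⟩ := ne_zero_and_v_lt_one_of_v_eq_exp hϖ
  have hq1 : 1 < Nat.card 𝓀[K] := Finite.one_lt_card
  rw [← Nat.card_eq_fintype_card]
  by_cases hpar : 2 ∣ s
  · obtain ⟨t', rfl⟩ := hpar
    have ht' : 1 ≤ t' := by omega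
    rw [stratumTwo_G1_zero_eq hvσ hfix hϖ T hs]
    simp only [Nat.mul_zero, Nat.zero_add]
    rw [rootPol_eq_root hσ hvσ hϖ0 hϖ1 T (2 * t') (dvd_mul_right 2 t') hs]
    by_cases htube : 1 + 2 * t' ≤ n₁
    · -- THE TUBE: the κ-count is constant on the family
      obtain ⟨P₀, hP₀fin, hP₀card, hP1, hP2, hP3⟩ := exists_fixed_class_representatives hσ hvσ hfix hϖ hdd 1 t' le_rfl
      set Rp : Finset K := hP₀fin.toFinset with hRpdef
      have hmemRp : ∀ f, f ∈ Rp ↔ f ∈ P₀ := fun f => Set.Finite.mem_toFinset hP₀fin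
      have hRpcard : Rp.card = (Nat.card 𝓀[K] - 1) * Nat.card 𝓀[K] ^ ((1 + 1) / 2 - 1) := by rw [hRpdef, ← Set.ncard_eq_toFinset_card P₀ hP₀fin]; exact hP₀card
      have hP1' : ∀ f ∈ Rp, σ f = f ∧ Valued.v f = Valued.v ϖ ^ (2 * t') := fun f hf => hP1 f ((hmemRp f).1 hf)
      have hP2' : ∀ f : K, σ f = f → Valued.v f = Valued.v ϖ ^ (2 * t') → ∃ g ∈ Rp, Valued.v (f - g) ≤ Valued.v ϖ ^ (1 + 2 * t') :=
        fun f hσf hvf => by obtain ⟨g, hg, h⟩ := hP2 f hσf hvf; exact ⟨g, (hmemRp g).2 hg, h⟩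
      have hP3' : ∀ g ∈ Rp, ∀ g' ∈ Rp, Valued.v (g - g') ≤ Valued.v ϖ ^ (1 + 2 * t') → g = g' :=
        fun g hg g' hg' h => hP3 g ((hmemRp g).1 hg) g' ((hmemRp g').1 hg') h
      set B : K → ℤ := fun f => (![if 2 * d ≤ 2 * t' + 2 then normSign σ (-1) * normSign σ (1 + f) else 0,
           if 2 * d ≤ 2 then normSign σ (-1) * normSign σ f * normSign σ (1 + f) else 0,
           if 2 * d ≤ 2 then normSign σ f else 0] : Fin 3 → ℤ) i with hB
      have hconst : ∀ M ∈ {M : Submodule 𝒪[K] (Fin 3 → K) | ∃ y ζ : K, Valued.v ζ = 1 ∧ Valued.v y = Valued.v ϖ ^ (2 * t') ∧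
          M = latt (!![1, 0, 0; 0, 1, 0; y, ζ, ϖ ^ (1 + 2 * t')] : Matrix (Fin 3) (Fin 3) K) ∧ mapGL T M = M},
          ((kappaCount σ ϖ 2 i M : ℤ) : ℚ) = ((∑ g ∈ Rp, B g : ℤ) : ℚ) := by
        rintro M ⟨y, ζ, hζ, hy, rfl, -⟩
        obtain ⟨V, hV'⟩ := exists_gl_coe_eq_glued (0 : K) ζ y (one_ne_zero) (pow_ne_zero (1 + 2 * t') hϖ0)
        have hV : (V : Matrix (Fin 3) (Fin 3) K) = !![1, 0, 0; 0, 1, 0; y, ζ, ϖ ^ (1 + 2 * t')] := by rw [hV', zero_mul, zero_add, one_mul]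
        rw [← hV, kappaCount_two_latt_glued_zero_rep hD h2 ht' hζ hy V hV Rp hP1' hP2' hP3' i]
      rw [finsum_mul_stabiliserWeight_eq_mul_finsum σ hconst,
        finsum_stabiliserWeight_rhoZero_tube_typeTwo_eq hσ hvσ hfix hϖ hdd hα hβ T hT h₁ h₂ (2 * t') (dvd_mul_right 2 t') htube (by omega),
        if_pos ⟨dvd_mul_right 2 t', htube⟩, show 2 * t' / 2 = t' by omega]
      -- the class sum at ρ = 0 (★ κG₂-B)
      have hlev := sum_bracket_two_level hD h2 ht' Rp hP1' (ρ := 0) (fun f hf hv => by simpa only [Nat.zero_add] using hP2' f hf hv)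
        (fun g hg g' hg' h => hP3' g hg g' hg' (by simpa only [Nat.zero_add] using h)) (by simpa only [Nat.zero_add] using hRpcard) i
      simp only [Nat.zero_add, show (1 + 1) / 2 - 1 = 0 by norm_num, pow_zero, mul_one] at hlev
      rw [show (((∑ g ∈ Rp, B g : ℤ)) : ℚ) = ∑ g ∈ Rp, ((B g : ℤ) : ℚ) by push_cast; rfl, hB, hlev]
      fin_cases i
      · simp only [Fin.zero_eta, Fin.isValue, Matrix.cons_val_zero]
        by_cases hdt : d ≤ t'
        · rw [if_pos hdt, if_neg (show ¬ (t' + 1 = d) by omega), if_pos (show 2 * d ≤ 2 * t' by omega), if_neg (show ¬ (2 * t' + 2 = 2 * d) by omega)]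
          ring
        · rw [if_neg hdt, if_neg (show ¬ (2 * d ≤ 2 * t') by omega)]
          by_cases hbd : t' + 1 = d
          · rw [if_pos hbd, if_pos (show 2 * t' + 2 = 2 * d by omega)]; ring
          · rw [if_neg hbd, if_neg (show ¬ (2 * t' + 2 = 2 * d) by omega)]; ring
      · simp
      · simp
    · -- BELOW THE TUBE: no stable root-glued frame
      have he : {M : Submodule 𝒪[K] (Fin 3 → K) | ∃ y ζ : K, Valued.v ζ = 1 ∧ Valued.v y = Valued.v ϖ ^ (2 * t') ∧
          M = latt (!![1, 0, 0; 0, 1, 0; y, ζ, ϖ ^ (1 + 2 * t')] : Matrix (Fin 3) (Fin 3) K) ∧ mapGL T M = M} = ∅ := by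
        refine Set.eq_empty_iff_forall_notMem.2 ?_
        rintro M ⟨y, ζ, hζ, -, rfl, hTM⟩
        obtain ⟨V, hV'⟩ := exists_gl_coe_eq_glued (0 : K) ζ y (one_ne_zero) (pow_ne_zero (1 + 2 * t') hϖ0)
        have hV : (V : Matrix (Fin 3) (Fin 3) K) = !![1, 0, 0; 0, 1, 0; y, ζ, ϖ ^ (1 + 2 * t')] := by rw [hV', zero_mul, zero_add, one_mul]
        rw [← hV] at hTM
        exact not_mapGL_latt_rhoZero_eq_of_lt hϖ hα hβ T hT h₁ (not_le.1 htube) hζ V hV hTM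
      rw [he, finsum_mem_empty, if_neg (fun h => htube h.2)]
  · rw [stratumTwo_G1_eq_empty_of_odd hvσ hfix hϖ T hpar, finsum_mem_empty, if_neg (fun h => hpar h.1)]

/-- **κB-G₂ «GLUED-STRATA κ-SOCKET» AT VERTEX TYPE `2`, ALL `ρ ≥ 0`** — LETTER κB-G₂ v1 §4 binder for binder (ρ ≥ 1: ★ κG₂-C2 p856830; ρ = 0: the root-glued head above, the glue
clause being vacuous since `n₂ ≥ N₀ ≥ d ≥ 1 = 2·0+1`). [cite: Kottwitz1986BaseChangeUnits, §1 pp. 240–241] [cite: LanglandsShelstad1987, §3] [cite: Rogawski1990, §4.9 Prop. 4.9.1 (a) p. 55] -/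
theorem finsum_kappaCount_two_mul_stabiliserWeight_hasAxis_G1_all (hD : IsRamifiedQuadraticDatum σ ϖ d t) (h2 : Valued.v (2 : K) < 1)
    (hE : IsElementDatum σ ϖ N₀ α β n₁ n₂ n₃) (hN₀ : d ≤ N₀) (hT : (T : Matrix (Fin 3) (Fin 3) K) = Matrix.diagonal ![α, β, 1])
    (ρ s : ℕ) (hs : 1 ≤ s) (i : Fin 3) (f₀ : K) (hf₀ : σ f₀ = f₀)
    (hglue : 2 ∣ s → n₂ = n₃ → n₁ = n₂ + s → n₂ < 2 * ρ + 1 → 2 * ρ + 1 ≤ 2 * n₂ → 2 * ρ + 1 - n₂ ≤ n₂ - d + 1 →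
      Valued.v (f₀ + (β - 1) / (α - 1)) ≤ Valued.v ϖ ^ (2 * ρ + 1 + s - n₂)) :
    ∑ᶠ M ∈ stratumTwo σ ϖ T ![2 * ρ + 1, 2 * ρ + 1 + s, 2 * ρ + 1 + s], (kappaCount σ ϖ 2 i M : ℚ) * stabiliserWeight σ M =
      (if 2 ∣ s ∧ 2 * ρ + 1 ≤ min n₂ n₃ ∧ 2 * ρ + 1 + s ≤ n₁ then
          (![(normSign σ (-1 : K) : ℚ) * (Fintype.card 𝓀[K] : ℚ) ^ (2 * ρ + s / 2) *
              ((if 2 * d ≤ s then (Fintype.card 𝓀[K] : ℚ) - 1 else 0) - (if s + 2 = 2 * d then 1 else 0)), 0, 0] : Fin 3 → ℚ) i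
        else 0) +
      (if 2 ∣ s ∧ n₂ = n₃ ∧ n₁ = n₂ + s ∧ n₂ < 2 * ρ + 1 ∧ 2 * ρ + 1 ≤ 2 * n₂ ∧ 2 * ρ + 1 - n₂ ≤ n₂ - d + 1 then
          (![if 2 * d ≤ s + 2 * ((2 * ρ + 1 - n₂ + 1) / 2) then (normSign σ (-1 : K) : ℚ) * normSign σ (1 + f₀) else 0,
             if d ≤ (2 * ρ + 1 - n₂ + 1) / 2 then (normSign σ (-1 : K) : ℚ) * normSign σ f₀ * normSign σ (1 + f₀) else 0,
             if d ≤ (2 * ρ + 1 - n₂ + 1) / 2 then (normSign σ f₀ : ℚ) else 0] : Fin 3 → ℚ) i *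
            (Fintype.card 𝓀[K] : ℚ) ^ (2 * ρ + s / 2 + 1 - (2 * ρ + 1 - n₂ + 1) / 2)
        else 0) := by
  rcases Nat.eq_zero_or_pos ρ with rfl | hρ
  · have h1d : 1 ≤ d := hD.2.2.2.2.2.1
    have hn : N₀ ≤ n₁ ∧ N₀ ≤ n₂ ∧ N₀ ≤ n₃ := ⟨hE.2.2.2.2.2.2.2.2.1, hE.2.2.2.2.2.2.2.2.2.1, hE.2.2.2.2.2.2.2.2.2.2⟩
    rw [finsum_kappaCount_two_mul_stabiliserWeight_hasAxis_G1_zero hD h2 hE hN₀ hT s hs i]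
    have hglue0 : ¬ (2 ∣ s ∧ n₂ = n₃ ∧ n₁ = n₂ + s ∧ n₂ < 2 * 0 + 1 ∧ 2 * 0 + 1 ≤ 2 * n₂ ∧ 2 * 0 + 1 - n₂ ≤ n₂ - d + 1) := fun h => by
      have := h.2.2.2.1; omega
    rw [if_neg hglue0, add_zero]
    by_cases h : 2 ∣ s ∧ 1 + s ≤ n₁
    · have h' : 2 ∣ s ∧ 2 * 0 + 1 ≤ min n₂ n₃ ∧ 2 * 0 + 1 + s ≤ n₁ := ⟨h.1, le_min (by omega) (by omega), by omega⟩
      rw [if_pos h, if_pos h', show 2 * 0 + s / 2 = s / 2 by omega]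
    · have h' : ¬ (2 ∣ s ∧ 2 * 0 + 1 ≤ min n₂ n₃ ∧ 2 * 0 + 1 + s ≤ n₁) := fun h' => h ⟨h'.1, by omega⟩
      rw [if_neg h, if_neg h']
  · exact finsum_kappaCount_two_mul_stabiliserWeight_hasAxis_G1 hD h2 hE hN₀ hT ρ s hρ hs i f₀ hf₀ hglue

end Socket

end Summit.HodgeConjecture.HodgeConjecture.Cruxes.H413.F0P3cDyRamDiagonalKappaGluedSocketTwoZero

end
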